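import Literature.AlgebraicGeometry.HodgeTheory.PerfectPairingTranspose
import Literature.AlgebraicGeometry.HodgeTheory.GlZariskiClosurePolynomialMap
import Literature.AlgebraicGeometry.HodgeTheory.ZariskiClosureRationalMap
import HarnessLib

/-!
# The block SECTION `GL(Π_i P_i) → End(M)` of a paired block decomposition `M = N₀ ⊕ ⊕_i (P_i ⊕ Q_i)`:
# a `K[x, 1/det]`-map reconstructing every pairing-preserving, piece-preserving automorphism trivial on
# `N₀` from its `P`-blocks (lane D of crux K1, hole S6 "block section"; Katz 1990 §1.8, Borel I.2.1)

Family `hodge`, layer `Literature/AlgebraicGeometry/HodgeTheory`. DEFINITIONS `blockComp`, `blockSection` and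
THEOREMS; layer L2 of hole S6 of the lane-D glue `stub_unitaryCommutatorsInMon_of_facts` of
`stmt-HodgeConjecture-19544` (memo LANE-D-ROADMAP-v2-Ax-g0 §2 S6). Setting: a finite-dimensional `M` over a
field `K` with submodules `N₀`, `P_i`, `Q_i` (`i ∈ J` finite), a bilinear form `β` on `M` whose restriction
`P_i × Q_i → K` is a perfect pairing, and a family of "projections" `pr₀, prP_i, prQ_i` onto the pieces
summing to the identity (supplied by the consumer: for the cyclic monodromy these are the eigen-projectors of
the deck transformation, `CyclicReflectionEigenprojectors`). The SECTION of `x ∈ GL(Π_i P_i)` is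
`sec x := ι₀ pr₀ + Σ_i (ι_{P_i} ∘ x_{ii} ∘ prP_i + ι_{Q_i} ∘ (x⁻¹)_{ii}ᵗ ∘ prQ_i)`, with `x_{ii}` the diagonal
blocks (`blockComp`) and `ᵗ` the `β`-transpose (`pairingTranspose`).
* `toMatrix_blockSection` — in any bases, `[sec x]_c = F([x]_b, 1/det [x]_b)` for an explicit matrix `F` over
  `K[x_{kl}][y]` (constant matrices, the generic matrix and the generic inverse of `GlZariskiClosureGroup`).
* `blockSection_piCongrRight_eq` — if `f ∈ GL(M)` preserves every `P_i`, `Q_i`, is the identity on `N₀` and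
  preserves the pairings `β|P_i × Q_i`, then `sec (⊕_i f|P_i) = f` (the `Q`-blocks of `f` are the
  contragredients of its `P`-blocks, `pairingTranspose_symm_eq_of_isometry`).
* `mem_glIdentityComponent_of_rationalMap_end` — the identity-component transport
  (`map_mem_glIdentityComponent_of_evalAtInvDet` / `mem_glIdentityComponent_of_rationalMap`) for an
  `End`-valued rational map that need not be invertible off the group: if `Φ(ψ θ) = θ` on `Θ ≤ GL(M)` for a
  homomorphism `ψ : Θ → GL(W)` and `g ∈ glIdentityComponent (ψ Θ)`, then any `g' ∈ GL(M)` with `g' = Φ g` lies in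
  `glIdentityComponent Θ`.
Written by the prover seat `hodge-nonav-prover-A` (cell `hodge-nonav`).

## References
* [Katz1990ESDE] N. M. Katz, *Exponential Sums and Differential Equations*, Ann. of Math. Stud. 124 (1990),
  §1.8 Prop. 1.8.2 (block structure `G ≤ Π GL(Vᵢ)`, contragredients).
* [Borel1991] A. Borel, *Linear Algebraic Groups*, 2nd ed., GTM 126 (1991), I.1.7, I.2.1 (b).
-/

noncomputable section

open Module Matrix Literature.AlgebraicGeometry.Motives

namespace Literature.AlgebraicGeometry.HodgeTheory

universe u v w

/-! ### §1 The identity-component transport for `End`-valued rational maps -/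

section Transport

variable {K : Type u} [Field K] {W : Type v} [AddCommGroup W] [Module K W] [Module.Finite K W]
  {M : Type w} [AddCommGroup M] [Module K M] [Module.Finite K M]
variable {ι : Type*} [Fintype ι] [DecidableEq ι] {κ : Type*} [Fintype κ] [DecidableEq κ]

omit [Module.Finite K W] in
/-- The matrix of an automorphism has non-zero determinant. [folklore] -/
private theorem det_toMatrix_ne_zero'' (b : Module.Basis ι K W) (g : W ≃ₗ[K] W) :
    (LinearMap.toMatrix b b (g : Module.End K W)).det ≠ 0 := by
  rw [LinearMap.det_toMatrix, ← LinearEquiv.coe_det]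
  exact (LinearEquiv.det g).ne_zero

/-- **Closure transport along an `End`-valued `K[x, 1/det]`-map**: `Φ : GL(W) → End(M)` with matrix
`F([g]_b, 1/det [g]_b)`; if `Φ(Λ) ⊆ Θ'` (as endomorphisms) and `g ∈ Λ^Zar(K)`, then every automorphism `g'`
of `M` with `g' = Φ g` lies in `(Θ')^Zar(K)`. [cite: Borel1991, I.2.1] -/
theorem mem_glZariskiClosure_of_rationalMap_end (b : Module.Basis ι K W) (c : Module.Basis κ K M)
    (Φ : (W ≃ₗ[K] W) → Module.End K M) (F : Matrix κ κ (Polynomial (MvPolynomial (ι × ι) K)))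
    (hΦ : ∀ g : W ≃ₗ[K] W, LinearMap.toMatrix c c (Φ g) =
      (evalAtInvDet (LinearMap.toMatrix b b (g : Module.End K W))).mapMatrix F)
    {Λ : Subgroup (W ≃ₗ[K] W)} {Θ' : Subgroup (M ≃ₗ[K] M)}
    (hΛ : ∀ γ ∈ Λ, ∃ θ ∈ Θ', (θ : Module.End K M) = Φ γ) {g : W ≃ₗ[K] W} (hg : g ∈ glZariskiClosure Λ)
    {g' : M ≃ₗ[K] M} (hg' : (g' : Module.End K M) = Φ g) : g' ∈ glZariskiClosure Θ' := by
  classical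
  rw [mem_glZariskiClosure_iff, ← zariskiClosureEnd_basis_indep b] at hg
  rw [mem_glZariskiClosure_iff, ← zariskiClosureEnd_basis_indep c]
  refine mem_zariskiClosureEndOfBasis_of_rationalMap b c F ?_ ?_ hg (det_toMatrix_ne_zero'' b g)
    (by rw [hg']; exact hΦ g)
  · rintro _ ⟨γ, hγ, rfl⟩
    obtain ⟨θ, hθ, hθγ⟩ := hΛ γ hγ
    exact ⟨(θ : Module.End K M), ⟨θ, hθ, rfl⟩, by rw [hθγ]; exact hΦ γ⟩
  · rintro _ ⟨γ, _, rfl⟩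
    exact det_toMatrix_ne_zero'' b γ

/-- **Identity-component transport along an `End`-valued rational left inverse** (the `End`-valued form of
`map_mem_glIdentityComponent_of_evalAtInvDet`): `Θ ≤ GL(M)`, `ψ : Θ →* GL(W)`, `Φ : GL(W) → End(M)` rational
with `Φ (ψ θ) = θ`; then `g ∈ ((ψ Θ)^Zar)°(K)` and `g' = Φ g ∈ GL(M)` give `g' ∈ (Θ^Zar)°(K)`.
[cite: Borel1991, I.2.1 and I.1.2] -/
theorem mem_glIdentityComponent_of_rationalMap_end (b : Module.Basis ι K W) (c : Module.Basis κ K M)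
    (Φ : (W ≃ₗ[K] W) → Module.End K M) (F : Matrix κ κ (Polynomial (MvPolynomial (ι × ι) K)))
    (hΦ : ∀ g : W ≃ₗ[K] W, LinearMap.toMatrix c c (Φ g) =
      (evalAtInvDet (LinearMap.toMatrix b b (g : Module.End K W))).mapMatrix F)
    (Θ : Subgroup (M ≃ₗ[K] M)) (ψ : Θ →* (W ≃ₗ[K] W)) (hsec : ∀ θ : Θ, Φ (ψ θ) = ((θ : M ≃ₗ[K] M) : Module.End K M))
    {g : W ≃ₗ[K] W} (hg : g ∈ glIdentityComponent ((⊤ : Subgroup Θ).map ψ))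
    {g' : M ≃ₗ[K] M} (hg' : (g' : Module.End K M) = Φ g) : g' ∈ glIdentityComponent Θ := by
  rw [mem_glIdentityComponent_iff] at hg ⊢
  intro Θ' hle hfi
  have hfi' : (((Θ'.subgroupOf Θ).map ψ).subgroupOf ((⊤ : Subgroup Θ).map ψ)).FiniteIndex := by
    refine finiteIndex_map_subgroupOf ψ ?_
    refine ⟨?_⟩
    rw [Subgroup.subgroupOf, Subgroup.index_comap_of_surjective _ (Subgroup.topEquiv (G := Θ)).surjective]
    exact hfi.index_ne_zero
  have hx := hg _ (Subgroup.map_mono le_top) hfi'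
  refine mem_glZariskiClosure_of_rationalMap_end b c Φ F hΦ ?_ hx hg'
  rintro _ ⟨θ, hθ, rfl⟩
  exact ⟨(θ : M ≃ₗ[K] M), Subgroup.mem_subgroupOf.1 hθ, (hsec θ).symm⟩

end Transport

/-! ### §2 Diagonal blocks and the section -/

section Section

variable {K : Type u} [Field K] {M : Type v} [AddCommGroup M] [Module K M]
  {J : Type w} [Fintype J] [DecidableEq J]
variable (P Q : J → Submodule K M) (N₀ : Submodule K M) (β : M →ₗ[K] M →ₗ[K] K)
  [hβ : ∀ i, (β.domRestrict₁₂ (P i) (Q i)).IsPerfPair]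
  (pr₀ : M →ₗ[K] N₀) (prP : ∀ i, M →ₗ[K] P i) (prQ : ∀ i, M →ₗ[K] Q i)

/-- The `i`-th diagonal block of an endomorphism of `Π_i P_i`. [cite: Katz1990ESDE, §1.8 Prop. 1.8.2] -/
def blockComp (i : J) (x : Module.End K (Π i, P i)) : Module.End K (P i) :=
  LinearMap.proj i ∘ₗ x ∘ₗ LinearMap.single K (fun i => P i) i

omit [Fintype J] in
/-- [cite: Katz1990ESDE, §1.8 Prop. 1.8.2] -/
@[simp] theorem blockComp_apply (i : J) (x : Module.End K (Π i, P i)) (p : P i) :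
    blockComp P i x p = x (Pi.single i p) i := rfl

omit [Fintype J] in
/-- The diagonal blocks of a block-diagonal automorphism `⊕_i u_i` are the `u_i`. [cite: Katz1990ESDE, §1.8 Prop. 1.8.2] -/
theorem blockComp_piCongrRight (u : Π i, (P i ≃ₗ[K] P i)) (i : J) :
    blockComp P i ((LinearEquiv.piCongrRight u : (Π i, P i) ≃ₗ[K] (Π i, P i)) : Module.End K (Π i, P i)) =
      (u i : P i →ₗ[K] P i) := by
  refine LinearMap.ext fun p => ?_
  rw [blockComp_apply, LinearEquiv.coe_coe, LinearEquiv.piCongrRight_apply, Pi.single_eq_same]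
  rfl

/-- **The block section** of `x ∈ GL(Π_i P_i)`: the endomorphism of `M` that is the identity on `N₀`, the
block `x_{ii}` on `P_i` and the `β`-transpose of `(x⁻¹)_{ii}` on `Q_i`, assembled through the projections.
[cite: Katz1990ESDE, §1.8 Prop. 1.8.2] -/
def blockSection (x : (Π i, P i) ≃ₗ[K] (Π i, P i)) : Module.End K M :=
  N₀.subtype ∘ₗ pr₀ + ∑ i, ((P i).subtype ∘ₗ blockComp P i (x : Module.End K (Π i, P i)) ∘ₗ prP i +
    (Q i).subtype ∘ₗ pairingTranspose (β.domRestrict₁₂ (P i) (Q i))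
      (blockComp P i ((x⁻¹ : (Π i, P i) ≃ₗ[K] (Π i, P i)) : Module.End K (Π i, P i))) ∘ₗ prQ i)

/-- The section, evaluated. [cite: Katz1990ESDE, §1.8 Prop. 1.8.2] -/
theorem blockSection_apply (x : (Π i, P i) ≃ₗ[K] (Π i, P i)) (m : M) :
    blockSection P Q N₀ β pr₀ prP prQ x m = (pr₀ m : M) + ∑ i, (((blockComp P i (x : Module.End K (Π i, P i)) (prP i m) : P i) : M) +
      ((pairingTranspose (β.domRestrict₁₂ (P i) (Q i))
        (blockComp P i ((x⁻¹ : (Π i, P i) ≃ₗ[K] (Π i, P i)) : Module.End K (Π i, P i))) (prQ i m) : Q i) : M)) := by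
  simp [blockSection, LinearMap.sum_apply]

/-- **Uniqueness / the section is a section.** If `f ∈ GL(M)` is the identity on `N₀`, preserves each `P_i`
with restrictions `u_i`, preserves each `Q_i`, and preserves the pairings `β|P_i × Q_i`, and the projections
decompose the identity and are compatible with the pieces, then `sec (⊕_i u_i) = f`: on `Q_i`, `f` is the
contragredient `((u_i)⁻¹)ᵗ` (`pairingTranspose`). [cite: Katz1990ESDE, §1.8 Prop. 1.8.2] -/
theorem blockSection_piCongrRight_eq
    (hsum : ∀ m : M, (pr₀ m : M) + ∑ i, (((prP i m : P i) : M) + ((prQ i m : Q i) : M)) = m)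
    (f : M ≃ₗ[K] M) (hf₀ : ∀ n : N₀, f n = n) (u : Π i, (P i ≃ₗ[K] P i))
    (hu : ∀ i (p : P i), ((u i p : P i) : M) = f p) (hfQ : ∀ i (q : Q i), f q ∈ Q i)
    (hfβ : ∀ i (p : P i) (q : Q i), β (f p) (f q) = β p q) :
    blockSection P Q N₀ β pr₀ prP prQ (LinearEquiv.piCongrRight u) = (f : Module.End K M) := by
  -- on `Q_i`, `f` is the `β`-transpose of `(u i)⁻¹`
  have hQ : ∀ i (q : Q i), ((pairingTranspose (β.domRestrict₁₂ (P i) (Q i)) ((u i).symm : P i →ₗ[K] P i) q : Q i) : M)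
      = f q := by
    intro i q
    let g : Q i →ₗ[K] Q i := ((f : Module.End K M).domRestrict (Q i)).codRestrict (Q i) fun q => hfQ i q
    have hg : ∀ q : Q i, ((g q : Q i) : M) = f q := fun q => rfl
    have hgt : g = pairingTranspose (β.domRestrict₁₂ (P i) (Q i)) ((u i).symm : P i →ₗ[K] P i) := by
      refine eq_pairingTranspose _ fun p q => ?_
      rw [LinearMap.domRestrict₁₂_apply, LinearMap.domRestrict₁₂_apply, hg, LinearEquiv.coe_coe]
      have h := hfβ i ((u i).symm p) q
      rw [← hu i, LinearEquiv.apply_symm_apply] at h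
      exact h
    rw [← hgt, hg]
  have hinv : ((LinearEquiv.piCongrRight u)⁻¹ : (Π i, P i) ≃ₗ[K] (Π i, P i)) =
      LinearEquiv.piCongrRight fun i => (u i).symm := rfl
  refine LinearMap.ext fun m => ?_
  rw [blockSection_apply]
  conv_rhs => rw [LinearEquiv.coe_coe, ← hsum m, map_add, map_sum]
  congr 1
  · exact (hf₀ (pr₀ m)).symm
  · refine Finset.sum_congr rfl fun i _ => ?_
    rw [map_add, hinv, blockComp_piCongrRight, blockComp_piCongrRight, LinearEquiv.coe_coe, hu, hQ]

end Section

/-! ### §3 The matrix of the section: entries in `K[x, 1/det]` -/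

/-- A constant matrix of any shape with entries in `K`, seen over `K[x][y]` (`x` indexed by `ι × ι`).
[cite: Borel1991, I.1.7] -/
def cst {K : Type u} [Field K] (ι : Type*) {m n : Type*} (A : Matrix m n K) :
    Matrix m n (Polynomial (MvPolynomial (ι × ι) K)) :=
  A.map fun a => Polynomial.C (MvPolynomial.C a)

/-- Constant matrices evaluate to themselves. [cite: Borel1991, I.1.7] -/
@[simp] theorem cst_map_evalAtInvDet {K : Type u} [Field K] {ι : Type*} [Fintype ι] [DecidableEq ι] {m n : Type*}
    (A : Matrix m n K) (X : Matrix ι ι K) : (cst ι A).map (evalAtInvDet X) = A := by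
  ext i j
  simp [cst]

section Matrices

variable {K : Type u} [Field K] {M : Type v} [AddCommGroup M] [Module K M]
  {J : Type w} [Fintype J] [DecidableEq J]
variable (P Q : J → Submodule K M) (N₀ : Submodule K M) (β : M →ₗ[K] M →ₗ[K] K)
  [hβ : ∀ i, (β.domRestrict₁₂ (P i) (Q i)).IsPerfPair]
  (pr₀ : M →ₗ[K] N₀) (prP : ∀ i, M →ₗ[K] P i) (prQ : ∀ i, M →ₗ[K] Q i)
variable {κ : Type*} [Fintype κ] [DecidableEq κ] {ι : Type*} [Fintype ι] [DecidableEq ι]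
  {α : J → Type*} [∀ i, Fintype (α i)] [∀ i, DecidableEq (α i)]

/-- The matrix of `x⁻¹` is the inverse matrix. [folklore] -/
private theorem toMatrix_inv_eq {W : Type*} [AddCommGroup W] [Module K W] (b : Module.Basis ι K W) (g : W ≃ₗ[K] W) :
    LinearMap.toMatrix b b ((g⁻¹ : W ≃ₗ[K] W) : Module.End K W) = (LinearMap.toMatrix b b (g : Module.End K W))⁻¹ := by
  refine (Matrix.inv_eq_left_inv ?_).symm
  rw [← LinearMap.toMatrix_mul, ← LinearEquiv.coe_toLinearMap_mul, inv_mul_cancel, LinearEquiv.coe_toLinearMap_one,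
    LinearMap.toMatrix_id]

/-- **The `K[x, 1/det]` formula for the section.** In bases `c` of `M`, `b` of `Π_i P_i`, `bP_i` of `P_i`
and `bQ_i` of `Q_i` (the latter two on a common index type, the pairing being perfect):
`[sec x]_c = F([x]_b, 1/det [x]_b)` for the explicit matrix
`F = C₀ + Σ_i (A_i · X · B_i + A'_i · (G_i⁻¹ · (D_i · X⁻¹ · E_i)ᵀ · G_i) · B'_i)` over `K[x][y]`
(`X` the generic matrix, `X⁻¹ = y · adj X` the generic inverse, all other factors constant).
[cite: Borel1991, I.1.7 and I.2.1] -/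
theorem toMatrix_blockSection (c : Module.Basis κ K M) (b : Module.Basis ι K (Π i, P i))
    (bP : ∀ i, Module.Basis (α i) K (P i)) (bQ : ∀ i, Module.Basis (α i) K (Q i)) :
    ∃ F : Matrix κ κ (Polynomial (MvPolynomial (ι × ι) K)), ∀ x : (Π i, P i) ≃ₗ[K] (Π i, P i),
      LinearMap.toMatrix c c (blockSection P Q N₀ β pr₀ prP prQ x) =
        (evalAtInvDet (LinearMap.toMatrix b b (x : Module.End K (Π i, P i)))).mapMatrix F := by
  classical
  -- the constant matrices
  let C₀ : Matrix κ κ K := LinearMap.toMatrix c c (N₀.subtype ∘ₗ pr₀)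
  let A : ∀ i, Matrix κ (α i) K := fun i => LinearMap.toMatrix (bP i) c (P i).subtype
  let B : ∀ i, Matrix (α i) κ K := fun i => LinearMap.toMatrix c (bP i) (prP i)
  let A' : ∀ i, Matrix κ (α i) K := fun i => LinearMap.toMatrix (bQ i) c (Q i).subtype
  let B' : ∀ i, Matrix (α i) κ K := fun i => LinearMap.toMatrix c (bQ i) (prQ i)
  let D : ∀ i, Matrix (α i) ι K := fun i => LinearMap.toMatrix b (bP i) (LinearMap.proj i)
  let E : ∀ i, Matrix ι (α i) K := fun i => LinearMap.toMatrix (bP i) b (LinearMap.single K (fun i => P i) i)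
  let G : ∀ i, Matrix (α i) (α i) K := fun i => Matrix.of fun k l => β.domRestrict₁₂ (P i) (Q i) (bP i k) (bQ i l)
  refine ⟨cst ι C₀ + ∑ i, (cst ι (A i) * (cst ι (D i) * genericMatrix ι K * cst ι (E i) * cst ι (B i)) +
    cst ι (A' i) * (cst ι ((G i)⁻¹) * (cst ι (D i) * genericInverse ι K * cst ι (E i))ᵀ * cst ι (G i) * cst ι (B' i))),
    fun x => ?_⟩
  set X := LinearMap.toMatrix b b (x : Module.End K (Π i, P i)) with hX
  have hgM : (genericMatrix ι K).map (evalAtInvDet X) = X := by rw [← RingHom.mapMatrix_apply, mapMatrix_genericMatrix]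
  have hgI : (genericInverse ι K).map (evalAtInvDet X) = X⁻¹ := by
    rw [← RingHom.mapMatrix_apply, mapMatrix_genericInverse]
  -- blocks in coordinates
  have hcomp : ∀ (y : Module.End K (Π i, P i)) (i : J),
      LinearMap.toMatrix (bP i) (bP i) (blockComp P i y) = D i * LinearMap.toMatrix b b y * E i := by
    intro y i
    rw [blockComp, LinearMap.toMatrix_comp (bP i) b (bP i), LinearMap.toMatrix_comp (bP i) b b, Matrix.mul_assoc]
  -- the left-hand side, block by block
  have hL : LinearMap.toMatrix c c (blockSection P Q N₀ β pr₀ prP prQ x) =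
      C₀ + ∑ i, (A i * (D i * X * E i * B i) + A' i * ((G i)⁻¹ * (D i * X⁻¹ * E i)ᵀ * G i * B' i)) := by
    rw [blockSection, map_add, map_sum]
    refine congrArg (C₀ + ·) (Finset.sum_congr rfl fun i _ => ?_)
    rw [map_add, LinearMap.toMatrix_comp c (bP i) c, LinearMap.toMatrix_comp c (bP i) (bP i), hcomp,
      LinearMap.toMatrix_comp c (bQ i) c, LinearMap.toMatrix_comp c (bQ i) (bQ i),
      toMatrix_pairingTranspose (β.domRestrict₁₂ (P i) (Q i)) (bP i) (bQ i), hcomp, toMatrix_inv_eq b x, ← hX,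
      Matrix.mul_assoc ((G i)⁻¹ * (D i * X⁻¹ * E i)ᵀ) (G i) (B' i)]
  -- the right-hand side: push the evaluation through the formula
  have hR : (evalAtInvDet X).mapMatrix (cst ι C₀ + ∑ i, (cst ι (A i) * (cst ι (D i) * genericMatrix ι K * cst ι (E i) * cst ι (B i)) +
      cst ι (A' i) * (cst ι ((G i)⁻¹) * (cst ι (D i) * genericInverse ι K * cst ι (E i))ᵀ * cst ι (G i) * cst ι (B' i)))) =
      C₀ + ∑ i, (A i * (D i * X * E i * B i) + A' i * ((G i)⁻¹ * (D i * X⁻¹ * E i)ᵀ * G i * B' i)) := by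
    rw [map_add, map_sum]
    simp only [RingHom.mapMatrix_apply, Matrix.map_mul, Matrix.transpose_map, cst_map_evalAtInvDet, hgM, hgI,
      Matrix.map_add _ (map_add (evalAtInvDet X))]
  rw [hL, hR]

end Matrices

end Literature.AlgebraicGeometry.HodgeTheory

end
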